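import Summits.BirchSwinnertonDyer.BirchSwinnertonDyer.Theorems.UniversalToricDescentThinCombWeakReflection
import Summits.BirchSwinnertonDyer.Rank1Residual.X2.HidaLimitCongruenceAlgebra
import HarnessLib

/-!
# Line `thin_comb` (v2) on the WALL `AdditiveSplitIMCInclusionAtThree` (stmt-BirchSwinnertonDyer-20395) — stub
# `stub_weakRigidity` CLOSED BY NAME (`--supports stmt-BirchSwinnertonDyer-20395`; cell `pub/bsd-wall`, lead `cruxlead-20395` g2)

The registered skeleton v2 `Cruxes/AdditiveSplitIMCInclusionAtThree/Lines/thin_comb.lean` (sha16 76d3467012f0f2fc) has the stub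
`stub_weakRigidity`: thin-comb rigidity over `R₀ = unrIntegers 3` for WEAK reflections (`ρ` fixes constants,
`ρ T₂ ∉ (3, T₂)`), integral form. It is the tree theorem `UniversalToricDescentThinComb.dvd_of_weakReflection`
(`…ThinCombWeakReflection.lean`, p693012) at `𝒪 = R₀`, a DVR with maximal ideal `(3)` (tree
`HidaLimitAlgebra.isDiscreteValuationRing_unrIntegers`, `irreducible_natCast_p`).

Nothing else of the line is addressed; BSD is not proved by any of this.
-/

set_option linter.dupNamespace false

noncomputable section

namespace Summit.BirchSwinnertonDyer.BirchSwinnertonDyer.Theorems.UniversalToricDescentThinCombLine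

open Literature.NumberTheory.EllipticCurves
open Summit.BirchSwinnertonDyer.BirchSwinnertonDyer.Theorems.UniversalToricDescentThinComb

/-- **`stub_weakRigidity` of line `thin_comb` v2, closed by name**: for `ρ` a constant-fixing automorphism of
`R₀⟦T₂⟧⟦T₁⟧` with `ρ T₂ ∉ (3, T₂)`, `ρ`-symmetric `G, F` with `F ∈ (G, Φ_{3^{m+1}}(1+T₂))` on levels of unbounded order
satisfy `G ∣ F`. [cite: Washington1997, §7.1–§7.2 and §13.4] -/
theorem stub_weakRigidity :
    ∀ (ρ : PowerSeries (PowerSeries (unrIntegers 3)) ≃+* PowerSeries (PowerSeries (unrIntegers 3))),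
      (∀ c : unrIntegers 3, ρ (const (unrIntegers 3) c) = const (unrIntegers 3) c) →
      ρ (T₂ (unrIntegers 3)) ∉ Ideal.span {const (unrIntegers 3) ((3 : ℕ) : unrIntegers 3), T₂ (unrIntegers 3)} →
      ∀ (G F : PowerSeries (PowerSeries (unrIntegers 3))), Associated (ρ G) G → Associated (ρ F) F →
        ThinCombDvdInt (unrIntegers 3) 3 G F → G ∣ F := by
  haveI := Summit.BirchSwinnertonDyer.Rank1Residual.X2.HidaLimitAlgebra.isDiscreteValuationRing_unrIntegers (p := 3)
  have hmax : IsLocalRing.maximalIdeal (unrIntegers 3) = Ideal.span {((3 : ℕ) : unrIntegers 3)} :=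
    (IsDiscreteValuationRing.irreducible_iff_uniformizer _).mp
      Summit.BirchSwinnertonDyer.Rank1Residual.X2.HidaLimitAlgebra.irreducible_natCast_p
  intro ρ hρc hρT G F hG hF hcomb
  exact dvd_of_weakReflection (unrIntegers 3) 3 hmax ρ hρc hρT G F hG hF hcomb

end Summit.BirchSwinnertonDyer.BirchSwinnertonDyer.Theorems.UniversalToricDescentThinCombLine

end
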